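import Summits.Ventures.HSemireg.UntwistCocycleTwist
import Mathlib.CategoryTheory.Equivalence
import HarnessLib

/-!
# Venture HSemireg — route R1.0 (untwisted reading): `F ↦ F ⊗ M` is an additive AUTOEQUIVALENCE of
# `Mod(𝒪_X)`, constructed (th-4 file #12; sequel of `UntwistCocycleTwist.lean`; v1.1: CONVENTIONS paragraph)

HONEST FRAMING. Category theory on the real carriers of `UntwistCocycleTwist.lean` (Mathlib's `X.Modules`, the
tree's `Modules.UnitCocycle`). Nothing is asserted about any variety; no gerbe is constructed; nothing here says
HC, HC_CM or HC_AV is proved.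

For a Čech cocycle of units `c = (U_x, g_{xy})` on a scheme `X` (class of the line bundle `M = lineBundle c`) the
cocycle twist `F ↦ F⟨c⟩` («`F ⊗ M`», sections `(s_x ∈ Γ(F, V ∩ U_x))_x` with `s_x = g_{xy} · s_y`) is made a
FUNCTOR `twistFunctor X c : X.Modules ⥤ X.Modules` (componentwise action on sections; additive), and the explicit
unit `f ↦ (g_{zx} · f)_{x,z} : F ⟶ F⟨c⟩⟨c⁻¹⟩` (`unitApp`; `c⁻¹ = UnitCocycle.inv c`, `g⁻¹_{xy} = g_{yx}`) is shown
to be a natural ISOMORPHISM — injective on sections because a section of `F` vanishing on every `V ∩ U_x`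
vanishes (locality of `F`), surjective because the diagonal coordinates `(S_x)_x ∈ Γ(F, V ∩ U_x)` of a section `S`
of `F⟨c⟩⟨c⁻¹⟩` agree on overlaps (`g_{yx} g_{xy} = 1`) and glue in `F`. Whence
**`twistEquivalence c : X.Modules ≌ X.Modules`** (functor `twistFunctor X c`, inverse `twistFunctor X c⁻¹`;
Mathlib's `Equivalence.mk`, which adjointifies the unit), additive on both sides: «`- ⊗ M` is an autoequivalence
of `Mod(𝒪_X)` with inverse `- ⊗ M^∨`» (The Stacks Project, Tag 01CR) — CONSTRUCTED, for the binder `Φ` of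
`UntwistExtEquivalence.lean` / `UntwistDerivedAdjunction.lean` / `UntwistComplexSigma.lean` (route R1.0 (i) in
the untwisted reading `E₀′ = E₀ ⊗ M_B` of record, lead R-49(a)/R-51(a)). The instantiation of those kernel
clauses with `Φ := twistEquivalence c` (so that `θ : Ext²(E₀,E₀) → Ext²(E₀⊗M_B, E₀⊗M_B)`, by value `18 → 18`
at the `g = 4` anchor, is a constructed bijection) is the sequel `UntwistCocycleTwistSigma.lean`.

CONVENTIONS (th-1 (P1) / red-4 (1) / ref-2 (b), so that the unit formula is checkable against Hartshorne III Ex. 4.5). The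
tree's cocycle condition is `g_{xy} · g_{yz} = g_{xz}`, `g_{xx} = 1` (`Modules/UnitCocycle.lean`, fields `g_mul`, `g_self`) on
the point-indexed cover `x ↦ U_x`; sections of `F⟨c⟩` are families with `s_x = g_{xy} · s_y` (file #11, `twistFamilies`), i.e.
`s_x` is the coordinate of the section in the local generator `t_x` of `M = lineBundle c`, `t_y = g_{xy} t_x`... precisely
`t_w = g_{zw} t_z` (`Modules/LineBundleOfCocycle.lineBundleGen_eq_smul`); the inverse cocycle is `c⁻¹ = UnitCocycle.inv c`,
`(c⁻¹).U = c.U`, `(c⁻¹).g_{xy} = g_{yx}` (`inv_U`, `inv_g`, both `rfl`), and `(c⁻¹)⁻¹ = c` definitionally (`inv_inv`). In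
`F⟨c⟩⟨c⁻¹⟩` the OUTER index `x` refers to `c⁻¹` and the INNER index `z` to `c`: a section over `V` is a family
`(S_x)_x`, `S_x ∈ Γ(F⟨c⟩, V ∩ U_x)`, `S_x = g_{yx} · S_y` (outer relation, `(c⁻¹).g_{xy} = g_{yx}`), each `S_x = (S_{x,z})_z` with
`S_{x,z} = g_{zw} · S_{x,w}` (inner relation). The unit sends `f ∈ Γ(F, V)` to `S_{x,z} = g_{zx} · f|_{V ∩ U_x ∩ U_z}`
(`comp_comp_unitApp_app`): the inner relation is `g_{zx} = g_{zw} g_{wx}` (`g_mul`), the outer one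
`g_{zx} = g_{yx} g_{zy}` (`g_mul` after commuting), and the diagonal coordinate is `S_{x,x} = f|_{V ∩ U_x}` (`g_{xx} = 1`),
which is why the unit is injective (locality of `F`) and surjective (glue the `S_{x,x}`, compatible since `g_{yx} g_{xy} = 1`).
For `F = 𝒪_X`, `𝒪_X⟨c⟩ ≅ lineBundle c` identically on families (file #15 `UntwistCocycleTwistLineBundle.twistUnitIso`), so
`M` is THE line bundle of Picard class `[c]` (`hasRank_lineBundle`, `detClass_lineBundle`).

WHAT `- ⊗ M` TRANSPORTS AND WHAT IT DOES NOT (th-1 (P3), ref-2 (b); wording of record «never unconditionally»): `θ` (the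
`Ext` / derived-`Hom` identification along `twistEquivalence`) is constructed and bijective (file #13), but
`I`-semiregularity moves along it ONLY through the triangular clause `hσ` (the Leibniz rule, declared) and ONLY for a LOWER
SET `I` or full `σ` (single components `σ_q`, `q ≥ 1`, are not transported unless `c₁(M) = 0`; `UntwistFullSigma.lean`
caveat theorem); local freeness IS transported (file #14 `isFiniteLocallyFree_twist`, th-1 (P2) / red-4 (2)).

## Contents (everything proved; 0 named facts; 0 sorry)

* `twistMap c φ`, `twistFunctor X c`, `twistFunctor_additive` — functoriality in `F`.
* `unitApp c F : F ⟶ F⟨c⟩⟨c⁻¹⟩` with `comp_comp_unitApp_app` (the formula `g_{zx} · f|`),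
  `unitApp_app_injective`, `unitApp_app_surjective`, `isIso_unitApp`, `unitApp_naturality`; `unitIso c`.
* **`twistEquivalence c`**, `twistEquivalence_functor/_inverse`, additivity instances,
  `isEquivalence_twistFunctor`.

## References

* The Stacks Project, Tag 01CR (invertible `𝒪_X`-modules; `- ⊗ 𝓛` an autoequivalence). [StacksProject]
* R. Hartshorne, *Algebraic Geometry*, GTM 52 (1977), II Ex. 1.22, III Ex. 4.5. [Hartshorne1977]
-/

noncomputable section

open CategoryTheory AlgebraicGeometry TopologicalSpace Opposite

namespace Summit.Ventures.HSemireg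

open Literature.AlgebraicGeometry.Modules

universe u

variable {X : Scheme.{u}} (c : UnitCocycle X)

namespace CocycleTwist

/-! ### The inverse cocycle (bookkeeping: `c⁻¹` has the same opens and `g⁻¹_{xy} = g_{yx}`) -/

/-- The inverse cocycle lives on the same cover. [folklore] -/
theorem inv_U (x : X) : c.inv.U x = c.U x := rfl

/-- The transition functions of the inverse cocycle: `g⁻¹_{xy} = g_{yx}`. [folklore] -/
theorem inv_g (x y : X) (V : X.Opens) (hx : V ≤ c.U x) (hy : V ≤ c.U y) :
    c.inv.g x y V hx hy = c.g y x V hy hx := rfl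

/-- `(c⁻¹)⁻¹ = c`, definitionally. [folklore] -/
theorem inv_inv : c.inv.inv = c := rfl

/-! ### Functoriality in `F`: the twist functor `- ⊗ M` -/

variable {F} {G : X.Modules}

/-- **`φ⟨c⟩ : F⟨c⟩ ⟶ G⟨c⟩`** for `φ : F ⟶ G`: componentwise `φ` (the relation is preserved because `φ` is
`𝒪_X`-linear and commutes with restriction). [folklore] -/
def twistMap (c : UnitCocycle X) (φ : F ⟶ G) : twist c F ⟶ twist c G :=
  homMkTwist c G
    (fun V =>
      { toFun := fun s => mkFamily c G (fun x => φ.app _ (comp c F s x)) (by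
          intro x y W hW hx hy
          change G.presheaf.map _ (φ.app _ (comp c F s x)) = _ • G.presheaf.map _ (φ.app _ (comp c F s y))
          rw [app_map_apply, app_map_apply, comp_rel c F s x y hW hx hy, Scheme.Modules.Hom.app_smul])
        map_zero' := twist_ext c G fun x => by rw [comp_mkFamily, comp_zero, comp_zero, map_zero]
        map_add' := fun s t => twist_ext c G fun x => by
          rw [comp_mkFamily, comp_add, comp_add, comp_mkFamily, comp_mkFamily, map_add] })
    (fun V W h s x => by
      change φ.app _ (comp c F ((twist c F).presheaf.map (homOfLE h).op s) x) =
        G.presheaf.map _ (φ.app _ (comp c F s x))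
      rw [comp_map, app_map_apply])
    (fun V a s x => by
      change φ.app _ (comp c F (a • s) x) = _ • φ.app _ (comp c F s x)
      rw [comp_smul, Scheme.Modules.Hom.app_smul])

/-- Components of `φ⟨c⟩ s`: `φ (s_x)`. [folklore] -/
@[simp]
theorem comp_twistMap_app (φ : F ⟶ G) (V : X.Opens) (s : Γ(twist c F, V)) (x : X) :
    comp c G ((twistMap c φ).app V s) x = φ.app _ (comp c F s x) := rfl

variable (F) in
/-- `(𝟙 F)⟨c⟩ = 𝟙`. [folklore] -/
@[simp]
theorem twistMap_id : twistMap c (𝟙 F) = 𝟙 (twist c F) := by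
  ext V s x
  rfl

/-- `(φ ≫ ψ)⟨c⟩ = φ⟨c⟩ ≫ ψ⟨c⟩`. [folklore] -/
theorem twistMap_comp {H : X.Modules} (φ : F ⟶ G) (ψ : G ⟶ H) :
    twistMap c (φ ≫ ψ) = twistMap c φ ≫ twistMap c ψ := by
  ext V s x
  rfl

variable (F G) in
/-- `0⟨c⟩ = 0`. [folklore] -/
@[simp]
theorem twistMap_zero : twistMap c (0 : F ⟶ G) = 0 := by
  ext V s x
  rfl

/-- `φ⟨c⟩` is additive in `φ`. [folklore] -/
theorem twistMap_add (φ ψ : F ⟶ G) : twistMap c (φ + ψ) = twistMap c φ + twistMap c ψ := by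
  ext V s x
  rfl

variable (X) in
/-- **The twist functor `F ↦ F⟨c⟩ = F ⊗ lineBundle c`** on all `𝒪_X`-modules — the functor «`- ⊗ M_B`» of the
untwisted reading of route R1.0, constructed. [cite: Hartshorne1977, II Ex. 1.22 and III Ex. 4.5] -/
def twistFunctor (c : UnitCocycle X) : X.Modules ⥤ X.Modules where
  obj F := twist c F
  map φ := twistMap c φ
  map_id F := twistMap_id c F
  map_comp φ ψ := twistMap_comp c φ ψ

/-- The twist functor is additive. [folklore] -/
instance twistFunctor_additive (c : UnitCocycle X) : (twistFunctor X c).Additive where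
  map_add := twistMap_add c _ _

/-- The twist functor on objects. [folklore] -/
@[simp]
theorem twistFunctor_obj (c : UnitCocycle X) (F : X.Modules) : (twistFunctor X c).obj F = twist c F := rfl

/-- The twist functor on morphisms. [folklore] -/
@[simp]
theorem twistFunctor_map (c : UnitCocycle X) {F G : X.Modules} (φ : F ⟶ G) :
    (twistFunctor X c).map φ = twistMap c φ := rfl

/-! ### The unit `F ⟶ F⟨c⟩⟨c⁻¹⟩`, `f ↦ (g_{zx} · f)_{x,z}` -/

section Unit

variable (F : X.Modules)

/-- The inner coordinates `z ↦ g_{zx} · f|` of the unit over `V ∩ U_x` (the open is spelled `V ⊓ c⁻¹.U x`, the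
index set of the outer twist; `c⁻¹.U = c.U`). [folklore] -/
def unitInner (V : X.Opens) (f : Γ(F, V)) (x : X) : PointFamily c F (V ⊓ c.inv.U x) :=
  fun z => c.g z x ((V ⊓ c.inv.U x) ⊓ c.U z) inf_le_right (inf_le_left.trans inf_le_right) •
    F.presheaf.map (homOfLE (inf_le_left.trans inf_le_left : (V ⊓ c.inv.U x) ⊓ c.U z ≤ V)).op f

/-- The value of the inner coordinate at `z`. [folklore] -/
theorem unitInner_apply (V : X.Opens) (f : Γ(F, V)) (x z : X) :
    unitInner c F V f x z = c.g z x ((V ⊓ c.inv.U x) ⊓ c.U z) inf_le_right (inf_le_left.trans inf_le_right) •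
      F.presheaf.map (homOfLE (inf_le_left.trans inf_le_left : (V ⊓ c.inv.U x) ⊓ c.U z ≤ V)).op f :=
  rfl

/-- The inner coordinates satisfy the relation of `F⟨c⟩` (`g_{zw} g_{wx} = g_{zx}`). [folklore] -/
theorem unitInner_mem (V : X.Opens) (f : Γ(F, V)) (x : X) :
    unitInner c F V f x ∈ twistFamilies c F (V ⊓ c.inv.U x) := by
  intro z w W hW hz hw
  rw [unitInner_apply, unitInner_apply, Scheme.Modules.map_smul, Scheme.Modules.map_smul, map_g_apply,
    map_g_apply, presheaf_map_map, presheaf_map_map, smul_smul, c.g_mul]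
  rfl

/-- The outer coordinates `x ↦ (g_{zx} · f|)_z ∈ Γ(F⟨c⟩, V ∩ U_x)` of the unit. [folklore] -/
def unitOuter (V : X.Opens) (f : Γ(F, V)) : PointFamily c.inv (twist c F) V :=
  fun x => mkFamily c F (unitInner c F V f x) (unitInner_mem c F V f x)

/-- Inner coordinates of the outer coordinates. [folklore] -/
theorem comp_unitOuter (V : X.Opens) (f : Γ(F, V)) (x z : X) :
    comp c F (unitOuter c F V f x) z = c.g z x ((V ⊓ c.inv.U x) ⊓ c.U z) inf_le_right (inf_le_left.trans inf_le_right) •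
      F.presheaf.map (homOfLE (inf_le_left.trans inf_le_left : (V ⊓ c.inv.U x) ⊓ c.U z ≤ V)).op f :=
  rfl

/-- The outer coordinates satisfy the relation of `(F⟨c⟩)⟨c⁻¹⟩` (`g_{zy} g_{yx} = g_{zx}`). [folklore] -/
theorem unitOuter_mem (V : X.Opens) (f : Γ(F, V)) : unitOuter c F V f ∈ twistFamilies c.inv (twist c F) V := by
  intro x y W hW hx hy
  apply twist_ext c F
  intro z
  rw [comp_map, comp_smul, comp_map, comp_unitOuter, comp_unitOuter, Scheme.Modules.map_smul,
    Scheme.Modules.map_smul, map_g_apply, map_g_apply, map_g_apply, presheaf_map_map, presheaf_map_map, smul_smul,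
    inv_g, mul_comm, c.g_mul]
  rfl

/-- The unit on sections over `V`, as an additive map. [folklore] -/
def unitAppSections (V : X.Opens) : Γ(F, V) →+ Γ(twist c.inv (twist c F), V) where
  toFun f := mkFamily c.inv (twist c F) (unitOuter c F V f) (unitOuter_mem c F V f)
  map_zero' := twist_ext c.inv (twist c F) fun x => twist_ext c F fun z => by
    rw [comp_mkFamily, comp_zero, comp_zero, comp_unitOuter, map_zero, smul_zero]
  map_add' f f' := twist_ext c.inv (twist c F) fun x => twist_ext c F fun z => by
    rw [comp_mkFamily, comp_add, comp_add, comp_mkFamily, comp_mkFamily, comp_unitOuter, comp_unitOuter,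
      comp_unitOuter, map_add, smul_add]

/-- Sections of `unitAppSections`: inner coordinates. [folklore] -/
theorem comp_comp_unitAppSections (V : X.Opens) (f : Γ(F, V)) (x z : X) :
    comp c F (comp c.inv (twist c F) (unitAppSections c F V f) x) z =
      c.g z x ((V ⊓ c.inv.U x) ⊓ c.U z) inf_le_right (inf_le_left.trans inf_le_right) •
        F.presheaf.map (homOfLE (inf_le_left.trans inf_le_left : (V ⊓ c.inv.U x) ⊓ c.U z ≤ V)).op f :=
  rfl

/-- **The unit `F ⟶ F⟨c⟩⟨c⁻¹⟩`**, `f ↦ (g_{zx} · f|_{V ∩ U_x ∩ U_z})_{x,z}`. [folklore] -/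
def unitApp : F ⟶ twist c.inv (twist c F) :=
  homMkTwist c.inv (twist c F) (unitAppSections c F)
    (fun V W h f x => twist_ext c F fun z => by
      rw [comp_map, comp_comp_unitAppSections, comp_comp_unitAppSections, Scheme.Modules.map_smul, map_g_apply,
        presheaf_map_map, presheaf_map_map]
      rfl)
    (fun V a f x => twist_ext c F fun z => by
      rw [comp_smul, comp_comp_unitAppSections, comp_comp_unitAppSections, Scheme.Modules.map_smul, smul_smul,
        smul_smul, ← CategoryTheory.comp_apply, ← Functor.map_comp, mul_comm]
      rfl)

/-- **Coordinates of the unit**: `((unit f)_x)_z = g_{zx} · f|`. [folklore] -/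
@[simp]
theorem comp_comp_unitApp_app (V : X.Opens) (f : Γ(F, V)) (x z : X) :
    comp c F (comp c.inv (twist c F) ((unitApp c F).app V f) x) z =
      c.g z x ((V ⊓ c.inv.U x) ⊓ c.U z) inf_le_right (inf_le_left.trans inf_le_right) •
        F.presheaf.map (homOfLE (inf_le_left.trans inf_le_left : (V ⊓ c.inv.U x) ⊓ c.U z ≤ V)).op f :=
  rfl

/-- `V` is covered by the opens `V ∩ U_x ∩ U_x` (every `v ∈ V` lies in `U_v`). [folklore] -/
theorem le_iSup_inf_inf (V : X.Opens) : V ≤ ⨆ x : X, (V ⊓ c.inv.U x) ⊓ c.U x := fun v hv =>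
  Opens.mem_iSup.mpr ⟨v, ⟨⟨hv, c.mem v⟩, c.mem v⟩⟩

/-- The unit is injective on sections: its diagonal coordinates are the restrictions `f|_{V ∩ U_x}`
(`g_{xx} = 1`), which determine `f` (locality of `F`). [folklore] -/
theorem unitApp_app_injective (V : X.Opens) : Function.Injective ((unitApp c F).app V) := by
  intro f f' h
  apply TopCat.Sheaf.eq_of_locally_eq' (⟨F.presheaf, Scheme.Modules.isSheaf F⟩ : TopCat.Sheaf Ab X)
    (fun x : X => (V ⊓ c.inv.U x) ⊓ c.U x) V (fun x => homOfLE (inf_le_left.trans inf_le_left))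
    (le_iSup_inf_inf c V)
  intro x
  have hx := congrArg (fun s => comp c F (comp c.inv (twist c F) s x) x) h
  simp only [comp_comp_unitApp_app, c.g_self, one_smul] at hx
  exact hx

/-- The unit is surjective on sections: the diagonal coordinates `(S_x)_x` of a section `S` of `F⟨c⟩⟨c⁻¹⟩` agree
on overlaps (`g_{yx} g_{xy} = 1`) and glue in `F` to a preimage. [folklore] -/
theorem unitApp_app_surjective (V : X.Opens) : Function.Surjective ((unitApp c F).app V) := by
  intro S
  -- the diagonal pieces `(S_x)_x`
  let t : ∀ x : X, Γ(F, (V ⊓ c.inv.U x) ⊓ c.U x) := fun x => comp c F (comp c.inv (twist c F) S x) x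
  have hcompat : TopCat.Presheaf.IsCompatible F.presheaf (fun x : X => (V ⊓ c.inv.U x) ⊓ c.U x) t := by
    intro x y
    -- the overlap `W₀` and the two relations of `S` read there
    have hW : (V ⊓ c.inv.U x) ⊓ c.U x ⊓ ((V ⊓ c.inv.U y) ⊓ c.U y) ≤ V :=
      inf_le_left.trans (inf_le_left.trans inf_le_left)
    have hx : (V ⊓ c.inv.U x) ⊓ c.U x ⊓ ((V ⊓ c.inv.U y) ⊓ c.U y) ≤ c.U x := inf_le_left.trans inf_le_right
    have hy : (V ⊓ c.inv.U x) ⊓ c.U x ⊓ ((V ⊓ c.inv.U y) ⊓ c.U y) ≤ c.U y := inf_le_right.trans inf_le_right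
    -- outer relation at `(x, y)`, read at the inner coordinate `x`
    have E1 := congrArg (fun u => comp c F u x) (comp_rel c.inv (twist c F) S x y hW hx hy)
    simp only [comp_map, comp_smul] at E1
    rw [map_g_apply, inv_g] at E1
    -- inner relation of `S_y` at `(x, y)` over `W₀ ∩ U_x`
    have E2 := comp_rel c F (comp c.inv (twist c F) S y) x y
      (W := (V ⊓ c.inv.U x) ⊓ c.U x ⊓ ((V ⊓ c.inv.U y) ⊓ c.U y) ⊓ c.U x)
      (le_inf (inf_le_left.trans hW) (inf_le_left.trans hy)) inf_le_right (inf_le_left.trans hy)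
    rw [E2, smul_smul, c.g_mul, c.g_self, one_smul] at E1
    -- `E1` is the compatibility over `W₀ ∩ U_x`; restrict it to `W₀`
    have E3 := congrArg (F.presheaf.map (homOfLE (le_inf le_rfl hx)).op) E1
    rw [presheaf_map_map, presheaf_map_map] at E3
    exact E3
  obtain ⟨f, hf⟩ := (TopCat.Sheaf.existsUnique_gluing' (⟨F.presheaf, Scheme.Modules.isSheaf F⟩ : TopCat.Sheaf Ab X)
    (fun x : X => (V ⊓ c.inv.U x) ⊓ c.U x) V (fun x => homOfLE (inf_le_left.trans inf_le_left))
    (le_iSup_inf_inf c V) t hcompat).exists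
  refine ⟨f, twist_ext c.inv (twist c F) fun x => twist_ext c F fun z => ?_⟩
  rw [comp_comp_unitApp_app]
  -- target: `g_{zx} · f| = (S_x)_z` over `W₂ = V ∩ U_x ∩ U_z`; compare after restriction to `W₂ ∩ U_z`
  have hW : (V ⊓ c.inv.U x) ⊓ c.U z ≤ V := inf_le_left.trans inf_le_left
  have hx : (V ⊓ c.inv.U x) ⊓ c.U z ≤ c.U x := inf_le_left.trans inf_le_right
  have hz : (V ⊓ c.inv.U x) ⊓ c.U z ≤ c.U z := inf_le_right
  have E1 := congrArg (fun u => comp c F u z) (comp_rel c.inv (twist c F) S x z hW hx hz)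
  simp only [comp_map, comp_smul] at E1
  rw [map_g_apply, inv_g] at E1
  -- `(S_z)_z = f|` by the gluing
  have hfz : comp c F (comp c.inv (twist c F) S z) z =
      F.presheaf.map (homOfLE (inf_le_left.trans inf_le_left)).op f :=
    (hf z).symm
  rw [hfz, presheaf_map_map] at E1
  -- undo the restriction `W₂ → W₂ ∩ U_z` (it has the retraction `W₂ ∩ U_z → W₂`)
  have E3 := congrArg (F.presheaf.map (homOfLE (le_inf le_rfl hz : (V ⊓ c.inv.U x) ⊓ c.U z ≤
    (V ⊓ c.inv.U x) ⊓ c.U z ⊓ c.U z)).op) E1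
  rw [presheaf_map_map, Scheme.Modules.map_smul, map_g_apply, presheaf_map_map] at E3
  have hid : ∀ k : Γ(F, (V ⊓ c.inv.U x) ⊓ c.U z),
      F.presheaf.map (homOfLE (le_inf le_rfl hz : (V ⊓ c.inv.U x) ⊓ c.U z ≤ (V ⊓ c.inv.U x) ⊓ c.U z ⊓ c.U z) ≫
        homOfLE (inf_le_inf_right (c.U z) (le_inf hW hx) :
          (V ⊓ c.inv.U x) ⊓ c.U z ⊓ c.U z ≤ (V ⊓ c.inv.U x) ⊓ c.U z)).op k = k := fun k => by
    rw [Subsingleton.elim (homOfLE (le_inf le_rfl hz : (V ⊓ c.inv.U x) ⊓ c.U z ≤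
        (V ⊓ c.inv.U x) ⊓ c.U z ⊓ c.U z) ≫ homOfLE (inf_le_inf_right (c.U z) (le_inf hW hx) :
        (V ⊓ c.inv.U x) ⊓ c.U z ⊓ c.U z ≤ (V ⊓ c.inv.U x) ⊓ c.U z)) (𝟙 _), op_id, F.presheaf.map_id]
    rfl
  rw [hid] at E3
  exact E3.symm

/-- **The unit is an isomorphism** `F ≅ F⟨c⟩⟨c⁻¹⟩`. [folklore] -/
instance isIso_unitApp : IsIso (unitApp c F) :=
  Scheme.Modules.Hom.isIso_iff_isIso_app.mpr fun V =>
    (ConcreteCategory.isIso_iff_bijective _).mpr ⟨unitApp_app_injective c F V, unitApp_app_surjective c F V⟩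

variable {F} {G : X.Modules}

/-- The unit is natural in `F`. [folklore] -/
theorem unitApp_naturality (φ : F ⟶ G) :
    unitApp c F ≫ twistMap c.inv (twistMap c φ) = φ ≫ unitApp c G := by
  ext V f x z
  rw [Scheme.Modules.Hom.comp_app, Scheme.Modules.Hom.comp_app, CategoryTheory.comp_apply,
    CategoryTheory.comp_apply, comp_twistMap_app, comp_twistMap_app, comp_comp_unitApp_app,
    comp_comp_unitApp_app, Scheme.Modules.Hom.app_smul, app_map_apply]

end Unit

/-! ### The autoequivalence -/

variable (X) in
/-- **The unit isomorphism `𝟭 ≅ (- ⊗ M) ⋙ (- ⊗ M^∨)`** of the cocycle twists by `c` and `c⁻¹`. [folklore] -/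
def unitIso : 𝟭 X.Modules ≅ twistFunctor X c ⋙ twistFunctor X c.inv :=
  NatIso.ofComponents (fun F => @asIso _ _ _ _ (unitApp c F) (isIso_unitApp c F))
    fun φ => (unitApp_naturality c φ).symm

variable (X) in
/-- **`- ⊗ M` is an additive autoequivalence of `Mod(𝒪_X)`**, constructed: the cocycle twist by `c` with inverse
the cocycle twist by `c⁻¹`, unit `F ≅ F⟨c⟩⟨c⁻¹⟩` and counit `G⟨c⁻¹⟩⟨c⟩ ≅ G` (the unit for `c⁻¹`, inverted;
`(c⁻¹)⁻¹ = c` definitionally). This is the functor `Φ` «intended `- ⊗ M_B`» of `UntwistExtEquivalence.lean`.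
[cite: StacksProject, Tag 01CR] -/
def twistEquivalence : X.Modules ≌ X.Modules :=
  CategoryTheory.Equivalence.mk (twistFunctor X c) (twistFunctor X c.inv) (unitIso X c) (unitIso X c.inv).symm

/-- The functor of the equivalence is the twist by `c`. [folklore] -/
@[simp]
theorem twistEquivalence_functor : (twistEquivalence X c).functor = twistFunctor X c := rfl

/-- The inverse of the equivalence is the twist by `c⁻¹`. [folklore] -/
@[simp]
theorem twistEquivalence_inverse : (twistEquivalence X c).inverse = twistFunctor X c.inv := rfl

/-- The functor of the equivalence is additive. [folklore] -/
instance twistEquivalence_functor_additive : (twistEquivalence X c).functor.Additive :=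
  twistFunctor_additive c

/-- The inverse of the equivalence is additive. [folklore] -/
instance twistEquivalence_inverse_additive : (twistEquivalence X c).inverse.Additive :=
  twistFunctor_additive c.inv

/-- The twist functor is an equivalence. [folklore] -/
instance isEquivalence_twistFunctor : (twistFunctor X c).IsEquivalence :=
  (twistEquivalence X c).isEquivalence_functor

end CocycleTwist

end Summit.Ventures.HSemireg

end
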